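import Summits.Langlands.Langlands.Theorems.IrreducibilityBySelfDualityReciprocityUpToIrreducibilityWeakExistence
import Summits.Langlands.Langlands.Theorems.IrreducibilityBySelfDualityVarmaWeilTracesUnramified
import Literature.NumberTheory.GaloisRepresentations.WeilLAdicCharacterProofs
import Literature.NumberTheory.GaloisRepresentations.InertiaCharacter
import Literature.NumberTheory.GaloisRepresentations.WeakAbelianDirectSummandCyclotomicProofs
import Literature.NumberTheory.GaloisRepresentations.LAdicRepFrobenius
import Literature.NumberTheory.GaloisRepresentations.FramedRepEquivConj
import Literature.NumberTheory.GaloisRepresentations.WeilGroupFrobeniusPowers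
import Literature.NumberTheory.Automorphic.ChebotarevArtinRepHolds
import Literature.NumberTheory.Automorphic.AutomorphicRepsGLOneHeckeCharacter
import Literature.NumberTheory.Automorphic.AlgebraicityParityGL
import Literature.NumberTheory.Automorphic.LocalLanglandsGLOne
import Literature.NumberTheory.Automorphic.LocalLanglandsDatumGLOne
import Literature.NumberTheory.Automorphic.HeckeCharacterLocalComponentSmooth
import Literature.NumberTheory.Automorphic.AutomorphicTwistSatake
import Literature.NumberTheory.Automorphic.WhittakerCoeffLocalDatum
import Literature.NumberTheory.Automorphic.ShintaniWhittakerFormula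
import Literature.NumberTheory.Automorphic.SatakeParameterGenericBoundFlathProofs
import HarnessLib

/-!
# Stub `stub_rankOne_corresponds_away_unramified` of line `Sketch` (crux `ReciprocityUpToIrreducibility`,
# item stmt-Langlands-14328; wave N16-B): rank one at the unramified places away from `ℓ`, every field

Support file (closes nothing).  For EVERY number field `K`, EVERY reciprocity datum `Rec`, every prime
`ℓ`, `ι : ℚ̄_ℓ ≃ ℂ` and every L-algebraic cuspidal `π` of `GL₁(𝔸_K)` we produce, with NO named fact,
a `ρ : Γ_K → GL₁(ℚ̄_ℓ)` which is Satake–Frobenius compatible with `(π, ι)` almost everywhere, is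
Satake–Frobenius compatible AND locally–globally compatible (the summit's clause
`LocalGlobalCompatibleAt`) at every place `v ∤ ℓ` where `π` is unramified, and is unique up to
conjugacy among the `ρ'` Satake–Frobenius compatible with `(π, ι)` almost everywhere:

* `π` transforms by `θ ∘ det` for a Hecke character `θ` (`exists_heckeCharacter_glOne`); L-algebraic
  = C-algebraic in odd rank, so `θ` has an infinity type (`exists_hasInfinityType_heckeCharacter_glOne`),
  i.e. is algebraic; `ρ` is Weil's `ℓ`-adic character of `θ` (`HeckeCharacter.IsAlgebraic.exists_lAdic`:
  at every `v ∤ ℓ` with `θ` unramified, `ρ` is unramified with `char ρ(Frob_v) = X - ι⁻¹(θ(ϖ_v))⁻¹`).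
* At a place `v` where `π` has a Satake parameter `α`, `θ` is unramified and `α = {θ(ϖ_v)}`
  (`isUnramifiedAt_heckeCharacter_glOne`, `exists_eq_singleton_of_hasSatakeParamAt_glOne`), and
  `arithFrobPolyOfSatake ι q_v 1 {θ(ϖ_v)} = X - ι⁻¹(θ(ϖ_v))⁻¹` (`arithFrobPolyOfSatake_one`):
  Satake–Frobenius compatibility at every unramified `v ∤ ℓ`, hence almost everywhere.
* Local–global compatibility at such `v` (the `v ∤ ℓ` branch of c4's
  `rankOne_localGlobalCompatibleAt_of_satakeFrobCompatibleAt`, which needs no `FontaineDatumExists`):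
  `π_v = θ_v ∘ det` is a local component (Flath in rank one), `r = (ρ|_{W_{K_v}}, 0)` is attached to
  `ρ|_{W_{K_v}}` by the Grothendieck–Deligne recipe (an inertia character `≠ 1` exists,
  `WeilGroup.exists_inertiaCharacter_ne_one_top`), and `(θ_v ∘ artin_v, 0)` — the representative of
  `rec_v(π_v)` (`LocalLanglandsDatum.recGL_one_mk`) — IS the transport of `r` along `ι`: both
  `w ↦ ι(ρ(w))` and `w ↦ θ_v(artin_v w)` kill `I_{K_v}` and send a geometric Frobenius `Φ` to
  `θ(ϖ_v)` (`W_{K_v} = ⟨Φ, I_{K_v}⟩`, `WeilGroup.intertwines_of_inertia_of_frob`; the Frobenius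
  dictionary `trace_toLocal_eq_of_isUnramifiedAt_of_hasFrobCharpolyAt`; `artin_v Φ` is a uniformiser).
* Uniqueness: Satake parameters are unique, rank one is semisimple, Chebotarev
  (`FramedGaloisRep.nonempty_equiv_of_hasFrobCharpolyAt_eventually`, `FramedRep.exists_eq_conj_of_equiv`).

Imports avoid every module reaching `Theses.IrreducibilityBySelfDuality`; the needed local pieces of
c4's `…AwayUnramified` / `…RankOneLocalComponent` / `…RankOneUnramified` are re-proved as private
`_aux` lemmas (attributed below).  No definitions; std axioms; no named fact.
(buildfix 2026-08-20: comment-only re-land to re-enqueue the module build after its blocking imports were repaired; no declaration changed.)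
-/

noncomputable section

set_option linter.dupNamespace false -- project-wide option (lakefile weak.linter.dupNamespace); `Summit.Langlands.Langlands` is the mandated namespace

open scoped NumberField Classical Polynomial MatrixGroups Matrix
open Filter IsDedekindDomain Field Polynomial
open Literature.NumberTheory.Automorphic Literature.NumberTheory.GaloisRepresentations
open Literature.NumberTheory.PAdicHodge
open Summit.Langlands
open Summit.Langlands.Langlands.Theorems.VarmaWeilTracesUnramified

namespace Summit.Langlands.Langlands.Theorems.ReciprocityUpToIrreducibility

section Local

variable {F : Type} [Field F] [ValuativeRel F] [TopologicalSpace F] [IsNonarchimedeanLocalField F]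
  {E : Type*} [Field E] [TopologicalSpace E] {n : ℕ}

/-- The matrix of `ρ|_{W_F}(w)` in the standard basis is `ρ(w)` (adapted from c4's
`toMatrix'_weilRestrict`, `…AwayUnramified`). [cite: TateCorvallis1979, (1.4.1)] -/
private theorem toMatrix'_weilRestrict_aux (ρ : FramedRep (absoluteGaloisGroup F) E n)
    (w : WeilGroup F) :
    LinearMap.toMatrix' (ρ.weilRestrict F w) =
      ((ρ.toWeilGroupHom w : GL (Fin n) E) : Matrix (Fin n) (Fin n) E) := by
  have h : ρ.weilRestrict F w =
      Matrix.toLin' ((ρ.toWeilGroupHom w : GL (Fin n) E) : Matrix (Fin n) (Fin n) E) := by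
    refine LinearMap.ext fun x => ?_
    rw [Matrix.toLin'_apply, FramedRep.weilRestrict_apply_apply, FramedRep.toWeilGroupHom_apply]
  rw [h, LinearMap.toMatrix'_toLin']

/-- **`(ρ|_{W_F}, 0)` is attached to a locally unramified `ρ` by the Grothendieck–Deligne recipe**,
granted a character of `I_F` not identically `1` (`U = I_F`, a geometric Frobenius, `N = 0`;
adapted from c4's `isWeilDeligneOfLadic_ofRep_weilRestrict`, `…AwayUnramified`).
[cite: TateCorvallis1979, (4.1.3)–(4.2.1)] [cite: DeligneAntwerpII1973, §8.4.2] -/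
private theorem isWeilDeligneOfLadic_ofRep_weilRestrict_aux [CharZero E]
    (ρ : FramedRep (absoluteGaloisGroup F) E n) (hρ : ρ.IsLocallyUnramified)
    (ht : ∃ t : WeilGroup.inertia F →* Multiplicative E, ∃ u : WeilGroup.inertia F, t u ≠ 1) :
    IsWeilDeligneOfLadic ρ.toWeilGroupHom
      (WeilDeligneRep.ofRep (ρ.weilRestrict F) hρ.isUnramifiedRep_weilRestrict.isContinuousRep) := by
  obtain ⟨t, u, htu⟩ := ht
  obtain ⟨Φ, hΦ⟩ := WeilGroup.deg_surjective IsFrobPow.mul_holds IsFrobPow.unique_holds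
    (exists_isFrobPow_holds F) (-1 : ℤ)
  refine IsWeilDeligneOfLadic.of_N_eq_zero ρ.toWeilGroupHom _ (WeilDeligneRep.ofRep_N _ _) t
    (WeilGroup.inertia F) le_rfl (WeilGroup.isOpen_inertia F) ⟨u, u.2, htu⟩ (fun w hw => ?_) Φ hΦ
    fun m w => ?_
  · rw [FramedRep.toWeilGroupHom_apply]
    exact hρ _ (WeilGroup.mem_inertia_iff.mp hw)
  · rw [WeilDeligneRep.ofRep_ρ, toMatrix'_weilRestrict_aux]

/-- **Rank one: `(χ ∘ artin, 0)` is the transport of `(ρ|_{W_F}, 0)` along `ι`.**  Let `χ` be a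
quasi-character of `Fˣ` trivial on `𝒪_Fˣ`, `ρ : Γ_F → GL₁(E)` locally unramified, and `Φ` a
geometric Frobenius with `ρ(Φ) = c • 1` and `ι(c) = χ(artin Φ)`.  Then the matrices of
`(χ ∘ artin • id, 0)` on `ℂ¹` are the `ι`-images of those of `(ρ|_{W_F}, 0)`: the homomorphisms
`w ↦ ι(ρ(w))` and `w ↦ χ(artin w) • 1` into `M₁(ℂ)` agree on `I_F` (both trivial: `ρ` is
unramified, `artin(I_F) = 𝒪_Fˣ`) and at `Φ`, hence everywhere (`W_F = ⟨Φ, I_F⟩`,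
`WeilGroup.intertwines_of_inertia_of_frob`). [cite: TateCorvallis1979, (1.4.1)–(1.4.6) and (4.1.3)] -/
private theorem rankOne_isTransportAlong_ofQuasiCharOn_aux [CharZero E] (L : LocalLanglandsDatum F)
    {χ : QuasiChar F}
    (hχ : ∀ u : Fˣ, u ∈ (ValuativeRel.valuation F).valuationSubring.unitGroup → χ u = 1)
    (ι : E →+* ℂ) (ρ : FramedRep (absoluteGaloisGroup F) E 1) (hρ : ρ.IsLocallyUnramified)
    {Φ : WeilGroup F} (hΦ : WeilGroup.deg Φ = -1) {c : E}
    (hΦc : ((ρ.toWeilGroupHom Φ : GL (Fin 1) E) : Matrix (Fin 1) (Fin 1) E) = c • 1)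
    (hc : ι c = ((χ (L.artin.artin Φ) : ℂˣ) : ℂ)) :
    (WeilDeligneRep.ofRep (ρ.weilRestrict F) hρ.isUnramifiedRep_weilRestrict.isContinuousRep).IsTransportAlong
      ι (WeilDeligneRep.ofQuasiCharOn (Fin 1 → ℂ) L.hns L.artin χ) := by
  refine ⟨fun w => ?_, ?_⟩
  · -- the two homomorphisms `W_F →* M₁(ℂ)`
    let R : WeilGroup F →* Matrix (Fin 1) (Fin 1) ℂ :=
      ι.mapMatrix.toMonoidHom.comp ((Units.coeHom (Matrix (Fin 1) (Fin 1) E)).comp ρ.toWeilGroupHom)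
    let R' : WeilGroup F →* Matrix (Fin 1) (Fin 1) ℂ :=
      (algebraMap ℂ (Matrix (Fin 1) (Fin 1) ℂ)).toMonoidHom.comp
        ((Units.coeHom ℂ).comp (χ.toMonoidHom.comp L.artin.artin))
    have hR : ∀ w, R w = ((ρ.toWeilGroupHom w : GL (Fin 1) E) : Matrix (Fin 1) (Fin 1) E).map ι :=
      fun w => rfl
    have hR' : ∀ w, R' w = ((χ (L.artin.artin w) : ℂˣ) : ℂ) • (1 : Matrix (Fin 1) (Fin 1) ℂ) :=
      fun w => by
        show algebraMap ℂ (Matrix (Fin 1) (Fin 1) ℂ) ((χ (L.artin.artin w) : ℂˣ) : ℂ) = _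
        exact Algebra.algebraMap_eq_smul_one _
    have hagree : ∀ w, 1 * R w = R' w * 1 := by
      refine WeilGroup.intertwines_of_inertia_of_frob R R' 1 hΦ ?_ fun u hu => ?_
      · rw [one_mul, mul_one, hR, hR', hΦc, Matrix.map_smul' _ _ _ (map_mul ι),
          Matrix.map_one _ (map_zero ι) (map_one ι), hc]
      · have hρu : ρ.toWeilGroupHom u = 1 := by
          rw [FramedRep.toWeilGroupHom_apply]
          exact hρ _ (WeilGroup.mem_inertia_iff.mp hu)
        have hχu : χ (L.artin.artin u) = 1 := by
          refine hχ _ ?_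
          rw [← L.artin.image_inertia]
          exact Subgroup.mem_map_of_mem L.artin.artin hu
        rw [one_mul, mul_one, hR, hR', hρu, hχu, Units.val_one, Units.val_one, one_smul,
          Matrix.map_one _ (map_zero ι) (map_one ι)]
    have hw := hagree w
    rw [one_mul, mul_one, hR, hR'] at hw
    have hL : (WeilDeligneRep.ofQuasiCharOn (Fin 1 → ℂ) L.hns L.artin χ).ρ w =
        ((χ (L.artin.artin w) : ℂˣ) : ℂ) • LinearMap.id := LinearMap.ext fun v => rfl
    rw [hL, LinearEquiv.map_smul, LinearMap.toMatrix'_id, WeilDeligneRep.ofRep_ρ,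
      toMatrix'_weilRestrict_aux, hw]
  · rw [WeilDeligneRep.ofRep_N, WeilDeligneRep.ofQuasiCharOn_N, map_zero, map_zero,
      Matrix.map_zero _ (map_zero ι)]

end Local

section RankOne

variable {K : Type} [Field K] [NumberField K] {ℓ : ℕ} [Fact ℓ.Prime]

/-- A `1 × 1` matrix is its trace times the identity. [folklore] -/
private theorem matrix_fin_one_eq_trace_smul_one_aux {R : Type*} [CommRing R]
    (M : Matrix (Fin 1) (Fin 1) R) : M = M.trace • (1 : Matrix (Fin 1) (Fin 1) R) := by
  ext i j
  fin_cases i; fin_cases j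
  simp [Matrix.trace_fin_one]

/-- Two uniformisers of `K_v` — one in the adelic normalisation `|ϖ|_v = exp(-1)`, one for the
canonical valuation of the local field `K_v` — differ by an element of the unit group `𝒪_vˣ`
(adapted from c4's `mul_inv_mem_unitGroup_of_isUniformizer`, `…RankOneUnramified`). [folklore] -/
private theorem mul_inv_mem_unitGroup_of_isUniformizer_aux {v : HeightOneSpectrum (𝓞 K)}
    {ϖ ϖ' : (v.adicCompletion K)ˣ} (hϖ : Valued.v (ϖ : v.adicCompletion K) = WithZero.exp (-1 : ℤ))
    (hϖ' : (ValuativeRel.valuation (v.adicCompletion K)).IsUniformizer (ϖ' : v.adicCompletion K)) :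
    ϖ' * ϖ⁻¹ ∈ (ValuativeRel.valuation (v.adicCompletion K)).valuationSubring.unitGroup := by
  have hval : ValuativeRel.valuation (v.adicCompletion K) (ϖ : v.adicCompletion K) =
      ValuativeRel.valuation (v.adicCompletion K) (ϖ' : v.adicCompletion K) :=
    (isUniformizingElement_of_valued_eq K v hϖ).valuation_eq (isUniformizingElement_of_isUniformizer hϖ')
  have h0 : ValuativeRel.valuation (v.adicCompletion K) (ϖ : v.adicCompletion K) ≠ 0 :=
    (Valuation.ne_zero_iff _).mpr ϖ.ne_zero
  rw [Valuation.mem_unitGroup_iff, Units.val_mul, Units.val_inv_eq_inv_val, map_mul, map_inv₀, ← hval,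
    mul_inv_cancel₀ h0]

variable {hcpt : isCompact_glFiniteIntegralLevel 1 K}

/-- **The local component of a `GL₁` datum acted on by `χ ∘ det` is `χ_v ∘ det`** (Flath in rank
one, explicit; adapted from c4's `hasLocalComponentAt_ofQuasiChar`, `…RankOneLocalComponent`): for
`φ ∈ W ∖ W'` the line `c ↦ c φ` is a local component map, since `det (ι_v g) = (det g)_v`
(`GLn.det_ofLocal`). [cite: FlathCorvallis1979, Thm. 3] [cite: BorelJacquetCorvallis1979, §4.6] -/
private theorem hasLocalComponentAt_ofQuasiChar_aux
    (π : AutomorphicRepData (AutomorphyDatum.gl 1 K hcpt)) (χ : HeckeCharacter K)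
    (hact : ∀ (g : (AdelicGroupData.gl 1 K).Adelic), ∀ φ ∈ π.W,
      rightTranslation (AdelicGroupData.gl 1 K) g φ -
        ((χ (Matrix.GeneralLinearGroup.det g) : ℂˣ) : ℂ) • φ ∈ π.W')
    (v : HeightOneSpectrum (𝓞 K)) (χv : QuasiChar (v.adicCompletion K))
    (hχv : ∀ u : (v.adicCompletion K)ˣ, χv u = χ.localComponent v u) :
    π.HasLocalComponentAt v (SmoothIrrep.ofQuasiChar χv).ρ := by
  obtain ⟨φ, hφW, hφW'⟩ := SetLike.exists_of_lt π.lt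
  show π.HasLocalComponentAt v (V := ℂ)
    (glOneRep (χv : (v.adicCompletion K)ˣ →* ℂˣ))
  refine ⟨LinearMap.toSpanSingleton ℂ ((AdelicGroupData.gl 1 K).Adelic → ℂ) φ, ?_, ?_, fun g x => ?_⟩
  · rw [← LinearMap.span_singleton_eq_range, Submodule.span_singleton_le_iff_mem]
    exact hφW
  · intro hle
    refine hφW' (?_ : φ ∈ π.W')
    have h := hle (LinearMap.mem_range_self _ (1 : ℂ))
    rwa [LinearMap.toSpanSingleton_apply_one] at h
  · have hW' := hact (GLn.ofLocal 1 K v g) φ hφW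
    rw [GLn.det_ofLocal, ← HeckeCharacter.localComponent_apply, ← hχv] at hW'
    have key : LinearMap.toSpanSingleton ℂ ((AdelicGroupData.gl 1 K).Adelic → ℂ) φ
          (glOneRep (χv : (v.adicCompletion K)ˣ →* ℂˣ) g x) -
        rightTranslation (AdelicGroupData.gl 1 K) (GLn.ofLocal 1 K v g)
          (LinearMap.toSpanSingleton ℂ ((AdelicGroupData.gl 1 K).Adelic → ℂ) φ x) =
        -(x • (rightTranslation (AdelicGroupData.gl 1 K) (GLn.ofLocal 1 K v g) φ -
          ((χv (Matrix.GeneralLinearGroup.det g) : ℂˣ) : ℂ) • φ)) := by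
      rw [LinearMap.toSpanSingleton_apply, LinearMap.toSpanSingleton_apply, map_smul,
        glOneRep_apply, smul_sub, neg_sub, smul_smul, mul_smul, mul_comm, mul_smul]
      rfl
    rw [key]
    exact π.W'.neg_mem (π.W'.smul_mem x hW')

/-- **Rank one: local–global compatibility at an unramified place `v ∤ ℓ` of the Hecke character,
for EVERY reciprocity datum, with NO named fact** (the `v ∤ ℓ` branch of c4's
`rankOne_localGlobalCompatibleAt_of_satakeFrobCompatibleAt`, freed of `FontaineDatumExists`).  Let
`GL₁(𝔸_K)` act on `π = W/W'` through `χ ∘ det`, `χ` unramified at `v ∤ ℓ`, and `ρ : Γ_K → GL₁(ℚ̄_ℓ)`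
Satake–Frobenius compatible with `π` at `v` (so `ρ` is unramified at `v` with
`char ρ(Frob_v^{arith}) = X - ι⁻¹(a)⁻¹`, `a = χ(ϖ_v)` the Satake parameter).  Witnesses of the clause:
`π_v = χ_v ∘ det` (`hasLocalComponentAt_ofQuasiChar_aux`), `r = (ρ|_{W_{K_v}}, 0)` (attached to
`ρ|_{W_{K_v}}` by the Grothendieck–Deligne recipe, an inertia character `≠ 1` existing by
`WeilGroup.exists_inertiaCharacter_ne_one_top`), `rℂ = (χ_v ∘ artin_v, 0)` — a transport of `r` along
`ι` (`rankOne_isTransportAlong_ofQuasiCharOn_aux`: geometric Frobenii act through `ρ` by `ι⁻¹(a)`,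
`trace_toLocal_eq_of_isUnramifiedAt_of_hasFrobCharpolyAt`, and `χ_v(artin_v Φ) = χ(ϖ_v) = a` since
`artin_v Φ` is a uniformiser) and the representative of `rec_v(π_v)` (`LocalLanglandsDatum.recGL_one_mk`).
[cite: BuzzardGeeLMS2014, Conj. 3.2.1–3.2.2 (n = 1)] [cite: TateCorvallis1979, (4.1.3)–(4.2.1)]
[cite: HarrisTaylorAMS2001, Thm. A (i)] -/
theorem rankOne_localGlobalCompatibleAt_away_of_satakeFrobCompatibleAt
    (Rec : ReciprocityData K) (ι : PadicAlgCl ℓ ≃+* ℂ)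
    (π : AutomorphicRepData (AutomorphyDatum.gl 1 K hcpt)) (χ : HeckeCharacter K)
    (hχ : ∀ (g : (AdelicGroupData.gl 1 K).Adelic), ∀ φ ∈ π.W,
      rightTranslation (AdelicGroupData.gl 1 K) g φ -
        ((χ (Matrix.GeneralLinearGroup.det g) : ℂˣ) : ℂ) • φ ∈ π.W')
    (ρ : FramedGaloisRep K (PadicAlgCl ℓ) 1) {v : HeightOneSpectrum (𝓞 K)}
    (hv : ((ℓ : ℕ) : 𝓞 K) ∉ v.asIdeal) (hur : χ.IsUnramifiedAt v)
    (hsat : SatakeFrobCompatibleAt ι π ρ v) :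
    LocalGlobalCompatibleAt Rec ι π ρ v := by
  obtain ⟨α, hα, hρ, hcp⟩ := hsat
  obtain ⟨ϖ, hϖ, rfl⟩ := π.exists_eq_singleton_of_hasSatakeParamAt_glOne hχ hα
  set a : ℂ := ((χ (localUnits v ϖ) : ℂˣ) : ℂ) with ha
  have hcp' : ρ.HasFrobCharpolyAt v
      ((({(ι.symm a)⁻¹} : Multiset (PadicAlgCl ℓ)).map fun b => X - C b).prod) := by
    rw [arithFrobPolyOfSatake_one, Multiset.map_singleton, Multiset.prod_singleton, map_inv₀] at hcp
    rwa [Multiset.map_singleton, Multiset.prod_singleton]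
  -- the local component `χ_v`, an unramified quasi-character of `K_vˣ`
  set L := Rec.llc v with hL
  let χv : QuasiChar (v.adicCompletion K) :=
    { toMonoidHom := χ.localComponent v
      continuous_toFun := χ.continuous_localComponent v }
  have hχv : ∀ u : (v.adicCompletion K)ˣ, χv u = χ.localComponent v u := fun _ => rfl
  have hχv1 : ∀ u : (v.adicCompletion K)ˣ,
      u ∈ (ValuativeRel.valuation (v.adicCompletion K)).valuationSubring.unitGroup → χv u = 1 :=
    fun u hu => (hχv u).trans
      (hur.localComponent_eq_one_of_valuation_eq_one ((Valuation.mem_unitGroup_iff _ _ _).mp hu))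
  -- a geometric Frobenius `Φ`; `ρ(Φ) = ι⁻¹(a) • 1`
  have hρloc : (ρ.toLocal v).IsLocallyUnramified := isLocallyUnramified_toLocal_of_isUnramifiedAt ρ v hρ
  obtain ⟨Φ, hΦ⟩ := WeilGroup.deg_surjective IsFrobPow.mul_holds IsFrobPow.unique_holds
    (exists_isFrobPow_holds (v.adicCompletion K)) (-1 : ℤ)
  have hdeg : IsFrobPow (WeilGroup.toAbsGalois (v.adicCompletion K) Φ) (-1) := by
    simpa [hΦ] using WeilGroup.isFrobPow_deg IsFrobPow.mul_holds Φ
  have htrace := trace_toLocal_eq_of_isUnramifiedAt_of_hasFrobCharpolyAt v ρ {(ι.symm a)⁻¹} hρ hcp'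
    (WeilGroup.toAbsGalois (v.adicCompletion K) Φ) (-1) hdeg
  have hM : (((ρ.toLocal v).toWeilGroupHom Φ : GL (Fin 1) (PadicAlgCl ℓ)) :
      Matrix (Fin 1) (Fin 1) (PadicAlgCl ℓ)) = ι.symm a • 1 := by
    rw [matrix_fin_one_eq_trace_smul_one_aux (((ρ.toLocal v).toWeilGroupHom Φ :
      GL (Fin 1) (PadicAlgCl ℓ)) : Matrix (Fin 1) (Fin 1) (PadicAlgCl ℓ)),
      FramedRep.toWeilGroupHom_apply, htrace]
    simp
  -- `a = χ_v(artin_v Φ)`: both `ϖ` and `artin_v Φ` are uniformisers, `χ_v` is unramified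
  have hkey : ((χv (L.artin.artin Φ) : ℂˣ) : ℂ) = a := by
    have hu := hχv1 _ (mul_inv_mem_unitGroup_of_isUniformizer_aux hϖ (L.artin.artin_frob Φ hΦ))
    have h1 : χv (L.artin.artin Φ) = χv ϖ := by
      have : L.artin.artin Φ = (L.artin.artin Φ * ϖ⁻¹) * ϖ := by group
      rw [this, map_mul, hu, one_mul]
    rw [h1, hχv, HeckeCharacter.localComponent_apply]
  have hc : (ι : PadicAlgCl ℓ →+* ℂ) (ι.symm a) = ((χv (L.artin.artin Φ) : ℂˣ) : ℂ) := by
    rw [hkey, RingHom.coe_coe, RingEquiv.apply_symm_apply]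
  refine ⟨SmoothIrrep.ofQuasiChar χv, _, WeilDeligneRep.ofQuasiCharOn (Fin 1 → ℂ) L.hns L.artin χv,
    hasLocalComponentAt_ofQuasiChar_aux π χ hχ v χv hχv,
    fun _ => isWeilDeligneOfLadic_ofRep_weilRestrict_aux (ρ.toLocal v) hρloc
      (WeilGroup.exists_inertiaCharacter_ne_one_top (F := v.adicCompletion K) (PadicAlgCl ℓ)),
    fun hv' => absurd hv' hv,
    rankOne_isTransportAlong_ofQuasiCharOn_aux L hχv1 (ι : PadicAlgCl ℓ →+* ℂ) (ρ.toLocal v) hρloc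
      hΦ hM hc, ?_⟩
  rw [L.recGL_one_mk (SmoothIrrep.ofQuasiChar_ρ_apply χv)]
  exact (WeilDeligneRep.isFrobSemisimple_ofQuasiCharOn L.hns L.artin χv).hasFrobSemisimpleClass

/-- **Rank one: Satake–Frobenius compatibility at an unramified place `v ∤ ℓ` of `π`.**  If
`GL₁(𝔸_K)` acts on `π = W/W'` through `θ ∘ det`, `ρ` is unramified with
`char ρ(Frob_v^{arith}) = X - ι⁻¹(θ(ϖ_v))⁻¹` at every `v ∤ ℓ` where `θ` is unramified (Weil's
character), and `π` has a Satake parameter `α` at `v ∤ ℓ`, then `θ` is unramified at `v`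
(`isUnramifiedAt_heckeCharacter_glOne`), `α = {θ(ϖ_v)}` (`exists_eq_singleton_of_hasSatakeParamAt_glOne`)
and `arithFrobPolyOfSatake ι q_v 1 α = X - ι⁻¹(θ(ϖ_v))⁻¹` (`arithFrobPolyOfSatake_one`), so `ρ` is
Satake–Frobenius compatible with `(π, ι)` at `v`. [cite: BuzzardGeeLMS2014, Conj. 3.2.1 and Rem. 3.2.5]
[cite: Weil1956, §1–§2] -/
theorem rankOne_satakeFrobCompatibleAt_of_hasSatakeParamAt (ι : PadicAlgCl ℓ ≃+* ℂ)
    (π : AutomorphicRepData (AutomorphyDatum.gl 1 K hcpt)) {θ : HeckeCharacter K}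
    (hθ : ∀ (g : (AdelicGroupData.gl 1 K).Adelic), ∀ φ ∈ π.W,
      rightTranslation (AdelicGroupData.gl 1 K) g φ -
        ((θ (Matrix.GeneralLinearGroup.det g) : ℂˣ) : ℂ) • φ ∈ π.W')
    {ρ : FramedGaloisRep K (PadicAlgCl ℓ) 1}
    (hρ : ∀ v : HeightOneSpectrum (𝓞 K), ((ℓ : ℕ) : 𝓞 K) ∉ v.asIdeal → θ.IsUnramifiedAt v →
      ρ.IsUnramifiedAt v ∧ ρ.HasFrobCharpolyAt v (X - C (ι.symm (θ.valueAtUniformizer v)⁻¹)))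
    {v : HeightOneSpectrum (𝓞 K)} (hv : ((ℓ : ℕ) : 𝓞 K) ∉ v.asIdeal) {α : Multiset ℂ}
    (hα : π.HasSatakeParamAt v α) :
    θ.IsUnramifiedAt v ∧ SatakeFrobCompatibleAt ι π ρ v := by
  have hur : θ.IsUnramifiedAt v := π.isUnramifiedAt_heckeCharacter_glOne hθ hα
  refine ⟨hur, α, hα, (hρ v hv hur).1, ?_⟩
  obtain ⟨ϖ, hϖ, rfl⟩ := π.exists_eq_singleton_of_hasSatakeParamAt_glOne hθ hα
  have hc : ((θ (localUnits v ϖ) : ℂˣ) : ℂ) = θ.valueAtUniformizer v := by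
    rw [← HeckeCharacter.localComponent_eq_valueAtUniformizer hur hϖ,
      HeckeCharacter.localComponent_apply]
  rw [arithFrobPolyOfSatake_one, Multiset.map_singleton, Multiset.prod_singleton, hc]
  exact (hρ v hv hur).2

/-- **Rank one: two `ρ`'s Satake–Frobenius compatible with one `π` almost everywhere are
conjugate** (Satake parameters are unique, `hasSatakeParamAt_unique_holds`; rank one is semisimple,
`FramedGaloisRep.isSemisimple_toGaloisRep_of_rank_one`; Chebotarev + Brauer–Nesbitt,
`FramedGaloisRep.nonempty_equiv_of_hasFrobCharpolyAt_eventually`; equivalent framed representations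
are conjugate, `FramedRep.exists_eq_conj_of_equiv`). [cite: DeligneSerreASENS1974, Lemme 3.2] -/
theorem rankOne_isConjugate_of_satakeFrobCompatibleAt (ι : PadicAlgCl ℓ ≃+* ℂ)
    (π : AutomorphicRepData (AutomorphyDatum.gl 1 K hcpt)) {ρ ρ' : FramedGaloisRep K (PadicAlgCl ℓ) 1}
    (h : ∀ᶠ v : HeightOneSpectrum (𝓞 K) in cofinite, SatakeFrobCompatibleAt ι π ρ v)
    (h' : ∀ᶠ v : HeightOneSpectrum (𝓞 K) in cofinite, SatakeFrobCompatibleAt ι π ρ' v) :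
    IsConjugate ρ ρ' := by
  have hev : ∀ᶠ v : HeightOneSpectrum (𝓞 K) in cofinite, ρ.IsUnramifiedAt v ∧ ρ'.IsUnramifiedAt v ∧
      ∃ P : Polynomial (PadicAlgCl ℓ), ρ.HasFrobCharpolyAt v P ∧ ρ'.HasFrobCharpolyAt v P := by
    filter_upwards [h, h'] with v hv hv'
    obtain ⟨α, hα, hur, hcp⟩ := hv
    obtain ⟨α', hα', hur', hcp'⟩ := hv'
    obtain rfl : α = α' := AutomorphicRepData.hasSatakeParamAt_unique_holds π hα hα'
    exact ⟨hur, hur', _, hcp, hcp'⟩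
  obtain ⟨e⟩ := FramedGaloisRep.nonempty_equiv_of_hasFrobCharpolyAt_eventually chebotarev_artinRep_holds
    ρ ρ' (FramedGaloisRep.isSemisimple_toGaloisRep_of_rank_one ρ)
    (FramedGaloisRep.isSemisimple_toGaloisRep_of_rank_one ρ') hev
  obtain ⟨P, hP⟩ := FramedRep.exists_eq_conj_of_equiv ρ ρ' e
  exact ⟨P, hP.symm⟩

end RankOne

/-- **Registered stub `stub_rankOne_corresponds_away_unramified` of line `Sketch` (crux
stmt-Langlands-14328, wave N16-B): rank one at the unramified places away from `ℓ`, for EVERY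
L-algebraic cuspidal `π` of `GL₁` over EVERY number field and EVERY reciprocity datum, with NO named
fact.**  `π` transforms by `θ ∘ det` (`exists_heckeCharacter_glOne`); L-algebraic = C-algebraic in odd
rank (`IsLAlgebraic.isCAlgebraic_of_odd`), so `θ` has an infinity type
(`exists_hasInfinityType_heckeCharacter_glOne`), i.e. is algebraic, and Weil's `ℓ`-adic character `ρ`
of `θ` (`HeckeCharacter.IsAlgebraic.exists_lAdic`) is: Satake–Frobenius compatible with `(π, ι)` at
every unramified place `v ∤ ℓ` of `π` (`rankOne_satakeFrobCompatibleAt_of_hasSatakeParamAt`), hence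
almost everywhere (Flath: `hasSatakeParamAt_cofinite_holds`); locally–globally compatible there
(`rankOne_localGlobalCompatibleAt_away_of_satakeFrobCompatibleAt`); and unique up to conjugacy among
the a.e.-compatible `ρ'` (`rankOne_isConjugate_of_satakeFrobCompatibleAt`).
[cite: BuzzardGeeLMS2014, Conj. 3.2.1–3.2.2 (n = 1)] [cite: Weil1956, §1–§2]
[cite: TateCorvallis1979, (4.2.1)] [cite: DeligneSerreASENS1974, Lemme 3.2] -/
theorem stub_rankOne_corresponds_away_unramified :
    ∀ (K : Type) [Field K] [NumberField K] (ℓ : ℕ) [Fact ℓ.Prime] (hcpt : isCompact_glFiniteIntegralLevel 1 K)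
      (Rec : ReciprocityData K) (ι : PadicAlgCl ℓ ≃+* ℂ) (π : CuspidalAutomorphicRepData 1 K hcpt), π.1.IsLAlgebraic →
      ∃ ρ : FramedGaloisRep K (PadicAlgCl ℓ) 1,
        (∀ᶠ v : HeightOneSpectrum (𝓞 K) in cofinite, SatakeFrobCompatibleAt ι π.1 ρ v) ∧
        (∀ v : HeightOneSpectrum (𝓞 K), ((ℓ : ℕ) : 𝓞 K) ∉ v.asIdeal → π.1.IsUnramifiedAt v →
          SatakeFrobCompatibleAt ι π.1 ρ v ∧ LocalGlobalCompatibleAt Rec ι π.1 ρ v) ∧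
        ∀ ρ' : FramedGaloisRep K (PadicAlgCl ℓ) 1,
          (∀ᶠ v : HeightOneSpectrum (𝓞 K) in cofinite, SatakeFrobCompatibleAt ι π.1 ρ' v) → IsConjugate ρ ρ' := by
  intro K _ _ ℓ _ hcpt Rec ι π hL
  -- the Hecke character `θ` of `π`; it is algebraic (L-algebraic = C-algebraic in odd rank)
  obtain ⟨θ, hθ⟩ := π.1.exists_heckeCharacter_glOne
  obtain ⟨T, hT, hTC⟩ := hL.isCAlgebraic_of_odd odd_one
  obtain ⟨p, q, hinf⟩ := π.1.exists_hasInfinityType_heckeCharacter_glOne hθ hT hTC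
  have halg : θ.IsAlgebraic := ⟨p, q, hinf⟩
  -- Weil's `ℓ`-adic character of `θ`
  obtain ⟨ρ, hρ⟩ := halg.exists_lAdic ι
  have hpt : ∀ v : HeightOneSpectrum (𝓞 K), ((ℓ : ℕ) : 𝓞 K) ∉ v.asIdeal → π.1.IsUnramifiedAt v →
      θ.IsUnramifiedAt v ∧ SatakeFrobCompatibleAt ι π.1 ρ v := fun v hv ⟨α, hα⟩ =>
    rankOne_satakeFrobCompatibleAt_of_hasSatakeParamAt ι π.1 hθ hρ hv hα
  have hae : ∀ᶠ v : HeightOneSpectrum (𝓞 K) in cofinite, SatakeFrobCompatibleAt ι π.1 ρ v := by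
    filter_upwards [π.1.hasSatakeParamAt_cofinite_holds, FramedGaloisRep.eventually_natCast_not_mem K ℓ]
      with v hv hvℓ
    exact (hpt v hvℓ hv).2
  refine ⟨ρ, hae, fun v hv hπv => ?_, fun ρ' h' => rankOne_isConjugate_of_satakeFrobCompatibleAt ι π.1 hae h'⟩
  obtain ⟨hur, hsat⟩ := hpt v hv hπv
  exact ⟨hsat, rankOne_localGlobalCompatibleAt_away_of_satakeFrobCompatibleAt Rec ι π.1 θ hθ ρ hv hur hsat⟩

end Summit.Langlands.Langlands.Theorems.ReciprocityUpToIrreducibility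

end
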